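import Summits.Ventures.PercRepro.RankLevelSetLevelSixHeavyCellSq28C
import Summits.Ventures.PercRepro.RankLevelSetCoreCircuitBounds
import Summits.Ventures.PercRepro.RankLevelSetLevelSixArithHeavySq28CM
import Summits.Ventures.PercRepro.RankLevelSetLevelSixArithHeavySq28CN
import Summits.Ventures.PercRepro.RankLevelSetLevelSixArithHeavySq28CO
import Summits.Ventures.PercRepro.RankLevelSetLevelSixArithHeavySq28CP
import Summits.Ventures.PercRepro.RankLevelSetLevelSixArithHeavySq28CQ
import Summits.Ventures.PercRepro.RankLevelSetLevelSixArithHeavySq28CR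
import Summits.Ventures.PercRepro.RankLevelSetLevelSixArithHeavySq28CS
import Summits.Ventures.PercRepro.RankLevelSetLevelSixArithHeavySq28CT
import Summits.Ventures.PercRepro.RankLevelSetLevelSixArithHeavySq28CU
import Summits.Ventures.PercRepro.RankLevelSetLevelSixArithHeavySq28CV
import Summits.Ventures.PercRepro.RankLevelSetLevelSixArithHeavySq28CW
import Summits.Ventures.PercRepro.S1TrianglePlusSharp
import Summits.Ventures.PercRepro.S1CoreFourCircuitSum


/-!
# PercRepro — THEOREM C₆ WITH THE CUBIC MULTIPLICITY, THE DISJOINT PAIR COUNT, THE WINDOWED HEAVY TERM AND THE CIRCUIT TABLES: LEVEL `5` AT `27` ⇒ C-025 AT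
LEVEL `6` FOR EVERY `p ≥ 28`, AND `c025_six_large_twenty_eight (28 ≤ p) : RLS M p 6` UNCONDITIONAL (p8 g6, S3)

`proofs/SUBCLAIM-S3-p8.md` §3s. The level-`6` row on the cell theorem `c025_core_six_heavy_cell_sq28c` (RankLevelSetLevelSixHeavyCellSq28C: flat bounds
`39 / 19`, p4's CUBIC MULTIPLICITY — fibre weights `1/cube(j + 1)`, `cube ν = ν(ν² + 1)/2` = `1, 1/5, 1/15, 1/34, 1/65, …` (RankLevelSetMultCubeCount on
`S2.card_pairs_ge_cube`), rational tails in the level-by-level form (the crude form at `d = 15`), THE WINDOWED HEAVY TERM, THE DISJOINT PAIR COUNT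
`P(n) = s₃·C(n − 3, 4) + s₄·C(n − 4, 3) + s₅·C(n − 5, 2) + s₆·(n − 6) + s₇` with `s₃ ≤ c3`, `s₄ ≤ c4`, `s₅ ≤ c5` as hypotheses), with the circuit bounds
p3's `cq3` table (`s₃ ≤ cq3 d` at `d ≤ 29`, TriangleCapEightI), p1's LEMMA T⁺⁺⁺ (`s₃ ≤ (d² − 3d + 6)/2` beyond, S1TrianglePlusSharp), p1's unconditional `s₄ ≤ 85 / 122` at `d = 7 / 8` (S1CoreCapUncond) with the averaging recursion `170 / 231 / 308 / 402` at `d = 9 … 12` (RankLevelSetFourCircuitAvgExt) and the 4-circuit table beyond (S1CoreFourCircuitSum), the 5-circuit averaging table `432 / 702 / 1092 / 1638 / 2382 / 3374` at `d = 7 … 12` (RankLevelSetFiveCircuitAvg) and the crude `C(d + 4, 5)` beyond. Every core cell `(p, 7 ≤ d ≤ 51)` at `p ≥ 28` by the cell theorem with the per-corank parameters of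
RankLevelSetLevelSixArithHeavySq28CA … W (`c025_core_six_bounded_corank_heavy_sq28c`); the cells `d ≥ 52` by
`c025_core_six_thirtynine_twenty_eight'` (RankLevelSetCoreSixLowSelfDG: the regime-II cells with the cube count up to `n = 91` and the corank key from `n₀ = 92`); level `5` for
`p ≥ 27` gives level `6` for `p ≥ 28` (`c025_six_of_five_heavy_sq28c`: rank `28` by `rls_six_at_of_core`, ranks `≥ 29` by
`rls_succ_large`). The UNCONDITIONAL row `c025_six_large_twenty_eight (28 ≤ p)` follows in RankLevelSetLevelSixHeavySq28CAll the minute a level-`5` row from `27` is in the tree (p7's `c025_five_large_three30` / the sharp chain). Axioms: standard.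
-/

open scoped Matroid

namespace PercRepro

namespace ThmN

open Set

variable {α : Type}

/-- **The `e`-free core at level `6`, corank `32 ≤ d ≤ 51`, rank `p ≥ 28`** (the cell theorem `c025_core_six_heavy_cell_sq28c` with the per-corank parameters of the parts; circuit bounds: p3's `cq3` table (`s₃ ≤ cq3 d` at `d ≤ 29`, TriangleCapEightI), p1's LEMMA T⁺⁺⁺ (`s₃ ≤ (d² − 3d + 6)/2` beyond, S1TrianglePlusSharp), p1's unconditional `s₄ ≤ 85 / 122` at `d = 7 / 8` (S1CoreCapUncond) with the averaging recursion `170 / 231 / 308 / 402` at `d = 9 … 12` (RankLevelSetFourCircuitAvgExt) and the 4-circuit table beyond (S1CoreFourCircuitSum), the 5-circuit averaging table `432 / 702 / 1092 / 1638 / 2382 / 3374` at `d = 7 … 12` (RankLevelSetFiveCircuitAvg) and the crude `C(d + 4, 5)` beyond). -/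
theorem c025_core_six_bounded_corank_heavy_sq28c_hi (M : Matroid α) [M.Finite] (p d : ℕ) (hp : 28 ≤ p) (hd32 : 32 ≤ d) (hd51 : d ≤ 51)
    (hR : M.eRank = (p : ℕ∞)) (hn : M.E.ncard = p + d)
    (hfree : ∀ e ∈ M.E, ∃ A ⊆ M.E \ {e}, e ∉ M.closure A ∧ e ∉ M.closure ((M.E \ {e}) \ A)) :
    RLS M p 6 := by
  have hd : M.E.encard = M.eRank + d := by
    rw [hR, ← M.ground_finite.cast_ncard_eq, hn]
    push_cast
    ring
  have hL : ∀ e ∈ M.E, ¬ M.IsLoop e := not_isLoop_of_free M hfree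
  have hs : ∀ e ∈ M.E, ∀ f ∈ M.E, e ≠ f → M.eRk {e, f} = 2 := by
    intro e he f hf hef
    have h2 : (2 : ℕ∞) ≤ M.eRk {e, f} :=
      two_le_eRk_of_two_le_ncard_of_free M hfree (pair_subset he hf) (by rw [ncard_pair hef])
    have h3 : M.eRk {e, f} ≤ 2 := by
      have := M.eRk_le_encard {e, f}
      rwa [encard_pair hef] at this
    exact le_antisymm h3 h2
  have hC1 : ∀ L ⊆ M.E, M.eRk L = 2 → L.ncard ≤ 3 :=
    fun L hL hr => ncard_le_three_of_eRk_two M hs hfree hL hr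
  have hC2 : ∀ P ⊆ M.E, M.eRk P ≤ 3 → P.ncard ≤ 6 :=
    fun P hP hr => ncard_le_six_of_eRk_le_three_of_free M hfree hP hr
  interval_cases d
  · exact c025_core_six_heavy_cell_sq28c M p 32 24 1 1 38 0 1 1350 1000 38 376992 8840 467
      (by norm_num) (by norm_num) (by norm_num) (by norm_num) (by norm_num) (by norm_num)
      (by norm_num [cnull]) (by norm_num [cnull]) (Or.inr ⟨by norm_num, by norm_num⟩) (Or.inr (Or.inr (by norm_num))) (Or.inr rfl) (by norm_num) (by norm_num) (by norm_num)
      ((S1.ncard_triangles_le_of_nullity_sharp M hC1 hC2 (by omega) hd).trans (by norm_num))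
      ((S1.ncard_fourCircuits_le_fourCircuitBound M hfree hd).trans (by decide +kernel))
      ((Matroid.ncard_circuits_le_choose_of_encard M hd 4).trans (by decide +kernel))
      (Or.inl (tail_six_heavy_sq28C_32 p hp)) hR hn hfree (level_six_poly_heavy_sq28C_32 p hp)
  · exact c025_core_six_heavy_cell_sq28c M p 33 24 1 1 39 0 1 1284 1000 39 435897 9673 498
      (by norm_num) (by norm_num) (by norm_num) (by norm_num) (by norm_num) (by norm_num)
      (by norm_num [cnull]) (by norm_num [cnull]) (Or.inr ⟨by norm_num, by norm_num⟩) (Or.inr (Or.inr (by norm_num))) (Or.inr rfl) (by norm_num) (by norm_num) (by norm_num)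
      ((S1.ncard_triangles_le_of_nullity_sharp M hC1 hC2 (by omega) hd).trans (by norm_num))
      ((S1.ncard_fourCircuits_le_fourCircuitBound M hfree hd).trans (by decide +kernel))
      ((Matroid.ncard_circuits_le_choose_of_encard M hd 4).trans (by decide +kernel))
      (Or.inl (tail_six_heavy_sq28C_33 p hp)) hR hn hfree (level_six_poly_heavy_sq28C_33 p hp)
  · exact c025_core_six_heavy_cell_sq28c M p 34 25 1 1 39 0 1 1230 1000 39 501942 10557 530
      (by norm_num) (by norm_num) (by norm_num) (by norm_num) (by norm_num) (by norm_num)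
      (by norm_num [cnull]) (by norm_num [cnull]) (Or.inr ⟨by norm_num, by norm_num⟩) (Or.inr (Or.inr (by norm_num))) (Or.inr rfl) (by norm_num) (by norm_num) (by norm_num)
      ((S1.ncard_triangles_le_of_nullity_sharp M hC1 hC2 (by omega) hd).trans (by norm_num))
      ((S1.ncard_fourCircuits_le_fourCircuitBound M hfree hd).trans (by decide +kernel))
      ((Matroid.ncard_circuits_le_choose_of_encard M hd 4).trans (by decide +kernel))
      (Or.inl (tail_six_heavy_sq28C_34 p hp)) hR hn hfree (level_six_poly_heavy_sq28C_34 p hp)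
  · exact c025_core_six_heavy_cell_sq28c M p 35 25 1 1 39 0 1 1185 1000 39 575757 11493 563
      (by norm_num) (by norm_num) (by norm_num) (by norm_num) (by norm_num) (by norm_num)
      (by norm_num [cnull]) (by norm_num [cnull]) (Or.inr ⟨by norm_num, by norm_num⟩) (Or.inr (Or.inr (by norm_num))) (Or.inr rfl) (by norm_num) (by norm_num) (by norm_num)
      ((S1.ncard_triangles_le_of_nullity_sharp M hC1 hC2 (by omega) hd).trans (by norm_num))
      ((S1.ncard_fourCircuits_le_fourCircuitBound M hfree hd).trans (by decide +kernel))
      ((Matroid.ncard_circuits_le_choose_of_encard M hd 4).trans (by decide +kernel))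
      (Or.inl (tail_six_heavy_sq28C_35 p hp)) hR hn hfree (level_six_poly_heavy_sq28C_35 p hp)
  · exact c025_core_six_heavy_cell_sq28c M p 36 26 1 1 39 0 1 1149 1000 39 658008 12483 597
      (by norm_num) (by norm_num) (by norm_num) (by norm_num) (by norm_num) (by norm_num)
      (by norm_num [cnull]) (by norm_num [cnull]) (Or.inr ⟨by norm_num, by norm_num⟩) (Or.inr (Or.inr (by norm_num))) (Or.inr rfl) (by norm_num) (by norm_num) (by norm_num)
      ((S1.ncard_triangles_le_of_nullity_sharp M hC1 hC2 (by omega) hd).trans (by norm_num))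
      ((S1.ncard_fourCircuits_le_fourCircuitBound M hfree hd).trans (by decide +kernel))
      ((Matroid.ncard_circuits_le_choose_of_encard M hd 4).trans (by decide +kernel))
      (Or.inl (tail_six_heavy_sq28C_36 p hp)) hR hn hfree (level_six_poly_heavy_sq28C_36 p hp)
  · exact c025_core_six_heavy_cell_sq28c M p 37 26 1 1 39 0 1 1120 1000 39 749398 13528 632
      (by norm_num) (by norm_num) (by norm_num) (by norm_num) (by norm_num) (by norm_num)
      (by norm_num [cnull]) (by norm_num [cnull]) (Or.inr ⟨by norm_num, by norm_num⟩) (Or.inr (Or.inr (by norm_num))) (Or.inr rfl) (by norm_num) (by norm_num) (by norm_num)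
      ((S1.ncard_triangles_le_of_nullity_sharp M hC1 hC2 (by omega) hd).trans (by norm_num))
      ((S1.ncard_fourCircuits_le_fourCircuitBound M hfree hd).trans (by decide +kernel))
      ((Matroid.ncard_circuits_le_choose_of_encard M hd 4).trans (by decide +kernel))
      (Or.inl (tail_six_heavy_sq28C_37 p hp)) hR hn hfree (level_six_poly_heavy_sq28C_37 p hp)
  · exact c025_core_six_heavy_cell_sq28c M p 38 27 1 1 39 0 1 1096 1000 39 850668 14630 668
      (by norm_num) (by norm_num) (by norm_num) (by norm_num) (by norm_num) (by norm_num)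
      (by norm_num [cnull]) (by norm_num [cnull]) (Or.inr ⟨by norm_num, by norm_num⟩) (Or.inr (Or.inr (by norm_num))) (Or.inr rfl) (by norm_num) (by norm_num) (by norm_num)
      ((S1.ncard_triangles_le_of_nullity_sharp M hC1 hC2 (by omega) hd).trans (by norm_num))
      ((S1.ncard_fourCircuits_le_fourCircuitBound M hfree hd).trans (by decide +kernel))
      ((Matroid.ncard_circuits_le_choose_of_encard M hd 4).trans (by decide +kernel))
      (Or.inl (tail_six_heavy_sq28C_38 p hp)) hR hn hfree (level_six_poly_heavy_sq28C_38 p hp)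
  · exact c025_core_six_heavy_cell_sq28c M p 39 27 1 1 39 0 1 1076 1000 39 962598 15790 705
      (by norm_num) (by norm_num) (by norm_num) (by norm_num) (by norm_num) (by norm_num)
      (by norm_num [cnull]) (by norm_num [cnull]) (Or.inr ⟨by norm_num, by norm_num⟩) (Or.inr (Or.inr (by norm_num))) (Or.inr rfl) (by norm_num) (by norm_num) (by norm_num)
      ((S1.ncard_triangles_le_of_nullity_sharp M hC1 hC2 (by omega) hd).trans (by norm_num))
      ((S1.ncard_fourCircuits_le_fourCircuitBound M hfree hd).trans (by decide +kernel))
      ((Matroid.ncard_circuits_le_choose_of_encard M hd 4).trans (by decide +kernel))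
      (Or.inl (tail_six_heavy_sq28C_39 p hp)) hR hn hfree (level_six_poly_heavy_sq28C_39 p hp)
  · exact c025_core_six_heavy_cell_sq28c M p 40 28 1 1 39 0 1 1060 1000 39 1086008 17010 743
      (by norm_num) (by norm_num) (by norm_num) (by norm_num) (by norm_num) (by norm_num)
      (by norm_num [cnull]) (by norm_num [cnull]) (Or.inr ⟨by norm_num, by norm_num⟩) (Or.inr (Or.inr (by norm_num))) (Or.inr rfl) (by norm_num) (by norm_num) (by norm_num)
      ((S1.ncard_triangles_le_of_nullity_sharp M hC1 hC2 (by omega) hd).trans (by norm_num))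
      ((S1.ncard_fourCircuits_le_fourCircuitBound M hfree hd).trans (by decide +kernel))
      ((Matroid.ncard_circuits_le_choose_of_encard M hd 4).trans (by decide +kernel))
      (Or.inl (tail_six_heavy_sq28C_40 p hp)) hR hn hfree (level_six_poly_heavy_sq28C_40 p hp)
  · exact c025_core_six_heavy_cell_sq28c M p 41 28 1 1 39 0 1 1047 1000 39 1221759 18291 782
      (by norm_num) (by norm_num) (by norm_num) (by norm_num) (by norm_num) (by norm_num)
      (by norm_num [cnull]) (by norm_num [cnull]) (Or.inr ⟨by norm_num, by norm_num⟩) (Or.inr (Or.inr (by norm_num))) (Or.inr rfl) (by norm_num) (by norm_num) (by norm_num)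
      ((S1.ncard_triangles_le_of_nullity_sharp M hC1 hC2 (by omega) hd).trans (by norm_num))
      ((S1.ncard_fourCircuits_le_fourCircuitBound M hfree hd).trans (by decide +kernel))
      ((Matroid.ncard_circuits_le_choose_of_encard M hd 4).trans (by decide +kernel))
      (Or.inl (tail_six_heavy_sq28C_41 p hp)) hR hn hfree (level_six_poly_heavy_sq28C_41 p hp)
  · exact c025_core_six_heavy_cell_sq28c M p 42 29 1 1 39 0 1 1037 1000 39 1370754 19635 822
      (by norm_num) (by norm_num) (by norm_num) (by norm_num) (by norm_num) (by norm_num)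
      (by norm_num [cnull]) (by norm_num [cnull]) (Or.inr ⟨by norm_num, by norm_num⟩) (Or.inr (Or.inr (by norm_num))) (Or.inr rfl) (by norm_num) (by norm_num) (by norm_num)
      ((S1.ncard_triangles_le_of_nullity_sharp M hC1 hC2 (by omega) hd).trans (by norm_num))
      ((S1.ncard_fourCircuits_le_fourCircuitBound M hfree hd).trans (by decide +kernel))
      ((Matroid.ncard_circuits_le_choose_of_encard M hd 4).trans (by decide +kernel))
      (Or.inl (tail_six_heavy_sq28C_42 p hp)) hR hn hfree (level_six_poly_heavy_sq28C_42 p hp)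
  · exact c025_core_six_heavy_cell_sq28c M p 43 29 1 1 39 0 1 1029 1000 39 1533939 21043 863
      (by norm_num) (by norm_num) (by norm_num) (by norm_num) (by norm_num) (by norm_num)
      (by norm_num [cnull]) (by norm_num [cnull]) (Or.inr ⟨by norm_num, by norm_num⟩) (Or.inr (Or.inr (by norm_num))) (Or.inr rfl) (by norm_num) (by norm_num) (by norm_num)
      ((S1.ncard_triangles_le_of_nullity_sharp M hC1 hC2 (by omega) hd).trans (by norm_num))
      ((S1.ncard_fourCircuits_le_fourCircuitBound M hfree hd).trans (by decide +kernel))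
      ((Matroid.ncard_circuits_le_choose_of_encard M hd 4).trans (by decide +kernel))
      (Or.inl (tail_six_heavy_sq28C_43 p hp)) hR hn hfree (level_six_poly_heavy_sq28C_43 p hp)
  · exact c025_core_six_heavy_cell_sq28c M p 44 30 1 1 39 0 1 1022 1000 39 1712304 22517 905
      (by norm_num) (by norm_num) (by norm_num) (by norm_num) (by norm_num) (by norm_num)
      (by norm_num [cnull]) (by norm_num [cnull]) (Or.inr ⟨by norm_num, by norm_num⟩) (Or.inr (Or.inr (by norm_num))) (Or.inr rfl) (by norm_num) (by norm_num) (by norm_num)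
      ((S1.ncard_triangles_le_of_nullity_sharp M hC1 hC2 (by omega) hd).trans (by norm_num))
      ((S1.ncard_fourCircuits_le_fourCircuitBound M hfree hd).trans (by decide +kernel))
      ((Matroid.ncard_circuits_le_choose_of_encard M hd 4).trans (by decide +kernel))
      (Or.inl (tail_six_heavy_sq28C_44 p hp)) hR hn hfree (level_six_poly_heavy_sq28C_44 p hp)
  · exact c025_core_six_heavy_cell_sq28c M p 45 30 1 1 39 0 1 1017 1000 39 1906884 24058 948
      (by norm_num) (by norm_num) (by norm_num) (by norm_num) (by norm_num) (by norm_num)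
      (by norm_num [cnull]) (by norm_num [cnull]) (Or.inr ⟨by norm_num, by norm_num⟩) (Or.inr (Or.inr (by norm_num))) (Or.inr rfl) (by norm_num) (by norm_num) (by norm_num)
      ((S1.ncard_triangles_le_of_nullity_sharp M hC1 hC2 (by omega) hd).trans (by norm_num))
      ((S1.ncard_fourCircuits_le_fourCircuitBound M hfree hd).trans (by decide +kernel))
      ((Matroid.ncard_circuits_le_choose_of_encard M hd 4).trans (by decide +kernel))
      (Or.inl (tail_six_heavy_sq28C_45 p hp)) hR hn hfree (level_six_poly_heavy_sq28C_45 p hp)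
  · exact c025_core_six_heavy_cell_sq28c M p 46 31 1 1 39 0 1 1013 1000 39 2118760 25668 992
      (by norm_num) (by norm_num) (by norm_num) (by norm_num) (by norm_num) (by norm_num)
      (by norm_num [cnull]) (by norm_num [cnull]) (Or.inr ⟨by norm_num, by norm_num⟩) (Or.inr (Or.inr (by norm_num))) (Or.inr rfl) (by norm_num) (by norm_num) (by norm_num)
      ((S1.ncard_triangles_le_of_nullity_sharp M hC1 hC2 (by omega) hd).trans (by norm_num))
      ((S1.ncard_fourCircuits_le_fourCircuitBound M hfree hd).trans (by decide +kernel))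
      ((Matroid.ncard_circuits_le_choose_of_encard M hd 4).trans (by decide +kernel))
      (Or.inl (tail_six_heavy_sq28C_46 p hp)) hR hn hfree (level_six_poly_heavy_sq28C_46 p hp)
  · exact c025_core_six_heavy_cell_sq28c M p 47 31 1 1 39 0 1 1010 1000 39 2349060 27348 1037
      (by norm_num) (by norm_num) (by norm_num) (by norm_num) (by norm_num) (by norm_num)
      (by norm_num [cnull]) (by norm_num [cnull]) (Or.inr ⟨by norm_num, by norm_num⟩) (Or.inr (Or.inr (by norm_num))) (Or.inr rfl) (by norm_num) (by norm_num) (by norm_num)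
      ((S1.ncard_triangles_le_of_nullity_sharp M hC1 hC2 (by omega) hd).trans (by norm_num))
      ((S1.ncard_fourCircuits_le_fourCircuitBound M hfree hd).trans (by decide +kernel))
      ((Matroid.ncard_circuits_le_choose_of_encard M hd 4).trans (by decide +kernel))
      (Or.inl (tail_six_heavy_sq28C_47 p hp)) hR hn hfree (level_six_poly_heavy_sq28C_47 p hp)
  · exact c025_core_six_heavy_cell_sq28c M p 48 32 1 1 39 0 1 1007 1000 39 2598960 29100 1083
      (by norm_num) (by norm_num) (by norm_num) (by norm_num) (by norm_num) (by norm_num)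
      (by norm_num [cnull]) (by norm_num [cnull]) (Or.inr ⟨by norm_num, by norm_num⟩) (Or.inr (Or.inr (by norm_num))) (Or.inr rfl) (by norm_num) (by norm_num) (by norm_num)
      ((S1.ncard_triangles_le_of_nullity_sharp M hC1 hC2 (by omega) hd).trans (by norm_num))
      ((S1.ncard_fourCircuits_le_fourCircuitBound M hfree hd).trans (by decide +kernel))
      ((Matroid.ncard_circuits_le_choose_of_encard M hd 4).trans (by decide +kernel))
      (Or.inl (tail_six_heavy_sq28C_48 p hp)) hR hn hfree (level_six_poly_heavy_sq28C_48 p hp)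
  · exact c025_core_six_heavy_cell_sq28c M p 49 32 1 1 39 0 1 1005 1000 39 2869685 30925 1130
      (by norm_num) (by norm_num) (by norm_num) (by norm_num) (by norm_num) (by norm_num)
      (by norm_num [cnull]) (by norm_num [cnull]) (Or.inr ⟨by norm_num, by norm_num⟩) (Or.inr (Or.inr (by norm_num))) (Or.inr rfl) (by norm_num) (by norm_num) (by norm_num)
      ((S1.ncard_triangles_le_of_nullity_sharp M hC1 hC2 (by omega) hd).trans (by norm_num))
      ((S1.ncard_fourCircuits_le_fourCircuitBound M hfree hd).trans (by decide +kernel))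
      ((Matroid.ncard_circuits_le_choose_of_encard M hd 4).trans (by decide +kernel))
      (Or.inl (tail_six_heavy_sq28C_49 p hp)) hR hn hfree (level_six_poly_heavy_sq28C_49 p hp)
  · exact c025_core_six_heavy_cell_sq28c M p 50 33 1 1 39 0 1 1004 1000 39 3162510 32825 1178
      (by norm_num) (by norm_num) (by norm_num) (by norm_num) (by norm_num) (by norm_num)
      (by norm_num [cnull]) (by norm_num [cnull]) (Or.inr ⟨by norm_num, by norm_num⟩) (Or.inr (Or.inr (by norm_num))) (Or.inr rfl) (by norm_num) (by norm_num) (by norm_num)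
      ((S1.ncard_triangles_le_of_nullity_sharp M hC1 hC2 (by omega) hd).trans (by norm_num))
      ((S1.ncard_fourCircuits_le_fourCircuitBound M hfree hd).trans (by decide +kernel))
      ((Matroid.ncard_circuits_le_choose_of_encard M hd 4).trans (by decide +kernel))
      (Or.inl (tail_six_heavy_sq28C_50 p hp)) hR hn hfree (level_six_poly_heavy_sq28C_50 p hp)
  · exact c025_core_six_heavy_cell_sq28c M p 51 33 1 1 39 0 1 1003 1000 39 3478761 34801 1227
      (by norm_num) (by norm_num) (by norm_num) (by norm_num) (by norm_num) (by norm_num)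
      (by norm_num [cnull]) (by norm_num [cnull]) (Or.inr ⟨by norm_num, by norm_num⟩) (Or.inr (Or.inr (by norm_num))) (Or.inr rfl) (by norm_num) (by norm_num) (by norm_num)
      ((S1.ncard_triangles_le_of_nullity_sharp M hC1 hC2 (by omega) hd).trans (by norm_num))
      ((S1.ncard_fourCircuits_le_fourCircuitBound M hfree hd).trans (by decide +kernel))
      ((Matroid.ncard_circuits_le_choose_of_encard M hd 4).trans (by decide +kernel))
      (Or.inl (tail_six_heavy_sq28C_51 p hp)) hR hn hfree (level_six_poly_heavy_sq28C_51 p hp)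


end ThmN

end PercRepro
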